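import Summits.CriticalPhenomena.CardyFormulaZ2.Theorems.CardyIKTransportIKLinearTransportStubPinnedSamplerCFTPCore

/-!
# Stub `stub_PinnedSampler` — coupling from the past along rows, part 2: the PROPP–WILSON LAW

Theorem-only support file (`--supports stmt-CriticalPhenomena-5076`, registered sub-goal
`ps2_cftp_jointLaw`). Setting (all hypotheses explicit, no definition): a row-resampling dynamics `Φ` of
the middle data in the environment `p = (eraseMid i x, stripDiagram i x)`, its sweeps `T` (rows
`a, …, a+n-1` in increasing order), certified coalescence events `Coal y m` (sound: a certified sweep of
the rows `y-m … y` forgets its start at row `y`), and the COUPLING-FROM-THE-PAST map `g (p, u)`: off the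
middle it copies `p.1`, and its middle bits at row `y` are those of the first certified sweep ending at `y`.

`ps2_cftp_jointLaw`: if every sweep of the rows `a … a+n-1` started from `X' ∼ νmix (S ∆ {i,i+1})` in its
own environment, with fresh bits, has — jointly with the pinned statistic, on the events not reading the
rows `≥ a+n` — the law of `X'` again (EXACTNESS: the row maps sample the conditional law of a middle row
given the pinned statistic and the middle rows below it), and certified depths are almost surely finite, then the pair (pinned statistic of `X'`, CFTP
output) has the law of (pinned statistic of `X'`, `X'`): the CFTP output is an exact sample of the
conditional law of the exchanged model given the pinned statistic, realised as a deterministic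
measurable function of (statistic, fresh bits). Proof: the sweep of rows `-n … n` from `X'` has the target
joint law for every `n` and agrees with the CFTP output on the rows `[-k, k]` outside an event whose
probability tends to `0` (continuity from above at the null event "no certified depth"); conclude by
extensionality over row-local events (`ps2_measure_ext_rows`).
-/

noncomputable section

namespace Summit.CriticalPhenomena.CardyFormulaZ2.Theorems.IKLinearTransport.PinnedDiagramExchange

open scoped Classical MeasureTheory ENNReal ProbabilityTheory symmDiff Topology
open Set MeasureTheory Filter
open Literature.Probability.Percolation Literature.Probability.LatticeModels

section Law

variable {S : Set ℤ} {i : ℤ} {Φ : ℤ → Obs × Set (Site 2 × Site 2) → Rnd → Obs → Obs}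
  {T : ℕ → ℤ → Obs × Set (Site 2 × Site 2) → Rnd → Obs → Obs}
  {Coal : ℤ → ℕ → Set ((Obs × Set (Site 2 × Site 2)) × Rnd)}
  {g : (Obs × Set (Site 2 × Site 2)) × Rnd → Obs}

/-- The pinned statistic is measurable. [folklore] -/
theorem ps2_measurable_stat (i : ℤ) : Measurable fun x : Obs => (eraseMid i x, stripDiagram i x) :=
  (measurable_eraseMid i).prodMk (ps_measurable_stripDiagram i)

/-- The coupling-from-the-past map is measurable (its bits are countable Boolean combinations of
certified-coalescence events and sweep bits). [folklore] -/
theorem ps2_measurable_cftp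
    (hT : ∀ n a p u z, T n a p u z = ((fun q : ℤ × Obs => (q.1 + 1, Φ q.1 p u q.2))^[n] (a, z)).2)
    (hΦm : ∀ y, Measurable fun t : (Obs × Set (Site 2 × Site 2)) × (Rnd × Obs) => Φ y t.1 t.2.1 t.2.2)
    (hCm : ∀ y m, MeasurableSet (Coal y m))
    (hg1 : ∀ p u (w : Site 2), w ∈ (g (p, u)).1 ↔ if w 0 = i + 1 then
      ∃ m : ℕ, ((p, u) ∈ Coal (w 1) m ∧ ∀ m' < m, (p, u) ∉ Coal (w 1) m') ∧
        w ∈ (T (m + 1) (w 1 - m) p u p.1).1 else w ∈ p.1.1)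
    (hg2 : ∀ p u (f : Site 2), f ∈ (g (p, u)).2 ↔ if (f 0 = i ∨ f 0 = i + 1) then
      ∃ m : ℕ, ((p, u) ∈ Coal (f 1) m ∧ ∀ m' < m, (p, u) ∉ Coal (f 1) m') ∧
        f ∈ (T (m + 1) (f 1 - m) p u p.1).2 else f ∈ p.1.2) :
    Measurable g := by
  have hsweep : ∀ (m : ℕ) (y : ℤ), Measurable fun q : (Obs × Set (Site 2 × Site 2)) × Rnd =>
      T (m + 1) (y - m) q.1 q.2 q.1.1 := fun m y =>
    (ps2_sweep_measurable hT hΦm (m + 1) (y - m)).comp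
      (measurable_fst.prodMk (measurable_snd.prodMk (measurable_fst.comp measurable_fst)))
  have hmin : ∀ (y : ℤ) (m : ℕ), Measurable fun q : (Obs × Set (Site 2 × Site 2)) × Rnd =>
      q ∈ Coal y m ∧ ∀ m' < m, q ∉ Coal y m' := fun y m =>
    (measurableSet_setOf.1 (hCm y m)).and (Measurable.forall fun m' =>
      Measurable.imp measurable_const (measurableSet_setOf.1 (hCm y m')).not)
  refine (measurable_set_iff.2 fun w => ?_).prodMk (measurable_set_iff.2 fun f => ?_)
  · have : (fun q : (Obs × Set (Site 2 × Site 2)) × Rnd => w ∈ (g q).1) = fun q =>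
        if w 0 = i + 1 then ∃ m : ℕ, (q ∈ Coal (w 1) m ∧ ∀ m' < m, q ∉ Coal (w 1) m') ∧
          w ∈ (T (m + 1) (w 1 - m) q.1 q.2 q.1.1).1 else w ∈ q.1.1.1 := by
      funext q; exact propext (hg1 q.1 q.2 w)
    rw [this]
    split_ifs
    · exact Measurable.exists fun m => (hmin _ m).and ((measurable_set_mem w).comp
        (measurable_fst.comp (hsweep m (w 1))))
    · exact (measurable_set_mem w).comp (measurable_fst.comp (measurable_fst.comp measurable_fst))
  · have : (fun q : (Obs × Set (Site 2 × Site 2)) × Rnd => f ∈ (g q).2) = fun q =>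
        if (f 0 = i ∨ f 0 = i + 1) then ∃ m : ℕ, (q ∈ Coal (f 1) m ∧ ∀ m' < m, q ∉ Coal (f 1) m') ∧
          f ∈ (T (m + 1) (f 1 - m) q.1 q.2 q.1.1).2 else f ∈ q.1.1.2 := by
      funext q; exact propext (hg2 q.1 q.2 f)
    rw [this]
    split_ifs
    · exact Measurable.exists fun m => (hmin _ m).and ((measurable_set_mem f).comp
        (measurable_snd.comp (hsweep m (f 1))))
    · exact (measurable_set_mem f).comp (measurable_snd.comp (measurable_fst.comp measurable_fst))

/-- AGREEMENT ON A WINDOW: if every row of `[-k, k]` has a certified depth `≤ n - k`, the CFTP output and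
the sweep of the rows `-n … n` started from `x` agree on all cells and faces of the rows `[-k, k]`. [folklore] -/
theorem ps2_cftp_agree_window
    (hT : ∀ n a p u z, T n a p u z = ((fun q : ℤ × Obs => (q.1 + 1, Φ q.1 p u q.2))^[n] (a, z)).2)
    (hW : ∀ y p u z, (∀ w : Site 2, w ≠ ![i + 1, y] → (w ∈ (Φ y p u z).1 ↔ w ∈ z.1)) ∧
      (∀ f : Site 2, f ≠ ![i, y] → f ≠ ![i + 1, y] → (f ∈ (Φ y p u z).2 ↔ f ∈ z.2)))
    (hCs : ∀ (y : ℤ) (m : ℕ) (p : Obs × Set (Site 2 × Site 2)) (u : Rnd), (p, u) ∈ Coal y m →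
      ∀ z : Obs, (![i + 1, y] ∈ (T (m + 1) (y - m) p u z).1 ↔ ![i + 1, y] ∈ (T (m + 1) (y - m) p u p.1).1) ∧
        (![i, y] ∈ (T (m + 1) (y - m) p u z).2 ↔ ![i, y] ∈ (T (m + 1) (y - m) p u p.1).2) ∧
        (![i + 1, y] ∈ (T (m + 1) (y - m) p u z).2 ↔ ![i + 1, y] ∈ (T (m + 1) (y - m) p u p.1).2))
    (hg1 : ∀ p u (w : Site 2), w ∈ (g (p, u)).1 ↔ if w 0 = i + 1 then
      ∃ m : ℕ, ((p, u) ∈ Coal (w 1) m ∧ ∀ m' < m, (p, u) ∉ Coal (w 1) m') ∧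
        w ∈ (T (m + 1) (w 1 - m) p u p.1).1 else w ∈ p.1.1)
    (hg2 : ∀ p u (f : Site 2), f ∈ (g (p, u)).2 ↔ if (f 0 = i ∨ f 0 = i + 1) then
      ∃ m : ℕ, ((p, u) ∈ Coal (f 1) m ∧ ∀ m' < m, (p, u) ∉ Coal (f 1) m') ∧
        f ∈ (T (m + 1) (f 1 - m) p u p.1).2 else f ∈ p.1.2)
    (k n : ℕ) (hkn : k ≤ n) (x : Obs) (u : Rnd)
    (hgood : ∀ y : ℤ, -(k : ℤ) ≤ y → y ≤ k →
      ∃ m ≤ n - k, ((eraseMid i x, stripDiagram i x), u) ∈ Coal y m)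
    (w : Site 2) (hw1 : -(k : ℤ) ≤ w 1) (hw2 : w 1 ≤ k) :
    (w ∈ (g ((eraseMid i x, stripDiagram i x), u)).1 ↔
      w ∈ (T (2 * n + 1) (-(n : ℤ)) (eraseMid i x, stripDiagram i x) u x).1) ∧
    (w ∈ (g ((eraseMid i x, stripDiagram i x), u)).2 ↔
      w ∈ (T (2 * n + 1) (-(n : ℤ)) (eraseMid i x, stripDiagram i x) u x).2) := by
  set p : Obs × Set (Site 2 × Site 2) := (eraseMid i x, stripDiagram i x) with hp
  set y := w 1 with hy
  -- the depth `d = y + n` sweep ending at row `y` starting at row `-n`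
  obtain ⟨d, hd⟩ : ∃ d : ℕ, (d : ℤ) = y + n := ⟨(y + n).toNat, by omega⟩
  obtain ⟨e, he⟩ : ∃ e : ℕ, 2 * n + 1 = (d + 1) + e := ⟨2 * n - d, by omega⟩
  have hstart : y - d = -(n : ℤ) := by omega
  have hex : ∃ m ≤ d, (p, u) ∈ Coal y m := by
    obtain ⟨m, hm, hmem⟩ := hgood y hw1 hw2
    exact ⟨m, by omega, hmem⟩
  have hbits := ps2_cftp_bits_eq hT hCs hex x
  rw [hstart] at hbits
  -- row stability: the rows above `y` resampled later do not touch row `y`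
  have hstable : ∀ v : Site 2, v 1 = y →
      ((v ∈ (T (2 * n + 1) (-(n : ℤ)) p u x).1 ↔ v ∈ (T (d + 1) (-(n : ℤ)) p u x).1) ∧
        (v ∈ (T (2 * n + 1) (-(n : ℤ)) p u x).2 ↔ v ∈ (T (d + 1) (-(n : ℤ)) p u x).2)) := by
    intro v hv
    rw [he]
    exact ps2_sweep_rowStable hT hW (d + 1) e _ p u x v (by push_cast; omega)
  have hoff := ps2_sweep_offRows hT hW (2 * n + 1) (-(n : ℤ)) p u x w
  refine ⟨?_, ?_⟩
  · rw [hg1 p u w]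
    split_ifs with hc
    · have hwv : w = ![i + 1, y] := by rw [ps2_eq_vec2 w, hc]
      rw [hwv, show (![i + 1, y] : Site 2) 1 = y from rfl, hbits.1, (hstable (![i + 1, y]) rfl).1]
    · rw [hoff.1 fun h => hc h.1]
      simp only [hp, eraseMid, mem_setOf_eq, and_iff_left_iff_imp]
      exact fun _ => hc
  · rw [hg2 p u w]
    split_ifs with hc
    · rcases hc with hc | hc
      · have hwv : w = ![i, y] := by rw [ps2_eq_vec2 w, hc]
        rw [hwv, show (![i, y] : Site 2) 1 = y from rfl, hbits.2.1, (hstable (![i, y]) rfl).2]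
      · have hwv : w = ![i + 1, y] := by rw [ps2_eq_vec2 w, hc]
        rw [hwv, show (![i + 1, y] : Site 2) 1 = y from rfl, hbits.2.2, (hstable (![i + 1, y]) rfl).2]
    · rw [hoff.2 fun h => hc h.1]
      simp only [hp, eraseMid, mem_setOf_eq, and_iff_left_iff_imp]
      exact fun _ => not_or.1 hc


/-- THE PROPP–WILSON LAW OF THE ROW CFTP SAMPLER (registered sub-goal). If every sweep of the middle rows
`a … a+n-1`, started from `X' ∼ νmix (S ∆ {i,i+1})` in its own environment with fresh bits, has again —
jointly with the pinned statistic, on the events not reading the rows `≥ a + n` — the law of `X'`, and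
almost surely every row has a certified depth, then the pair
(pinned statistic, CFTP output) under `νmix (S ∆ {i,i+1}) ⊗ β` has the law of (pinned statistic, `X'`):
the coupling-from-the-past output is an exact sample of the conditional law of the exchanged model given
the pinned statistic. [folklore] -/
theorem ps2_cftp_jointLaw :
    ∀ (S : Set ℤ) (i : ℤ) (Φ : ℤ → Obs × Set (Site 2 × Site 2) → Rnd → Obs → Obs)
      (T : ℕ → ℤ → Obs × Set (Site 2 × Site 2) → Rnd → Obs → Obs)
      (Coal : ℤ → ℕ → Set ((Obs × Set (Site 2 × Site 2)) × Rnd))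
      (g : (Obs × Set (Site 2 × Site 2)) × Rnd → Obs),
      (∀ n a p u z, T n a p u z = ((fun q : ℤ × Obs => (q.1 + 1, Φ q.1 p u q.2))^[n] (a, z)).2) →
      (∀ y, Measurable fun t : (Obs × Set (Site 2 × Site 2)) × (Rnd × Obs) => Φ y t.1 t.2.1 t.2.2) →
      (∀ y p u z, (∀ w : Site 2, w ≠ ![i + 1, y] → (w ∈ (Φ y p u z).1 ↔ w ∈ z.1)) ∧
        (∀ f : Site 2, f ≠ ![i, y] → f ≠ ![i + 1, y] → (f ∈ (Φ y p u z).2 ↔ f ∈ z.2))) →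
      (∀ (n : ℕ) (a : ℤ) (D : Set ((Obs × Set (Site 2 × Site 2)) × Obs)), MeasurableSet D →
        (∀ (p : Obs × Set (Site 2 × Site 2)) (z z' : Obs), (∀ w : Site 2, w 1 < a + n →
          (w ∈ z.1 ↔ w ∈ z'.1) ∧ (w ∈ z.2 ↔ w ∈ z'.2)) → ((p, z) ∈ D ↔ (p, z') ∈ D)) →
        ((νmix (symmDiff S {i, i + 1})).prod β) {xu | ((eraseMid i xu.1, stripDiagram i xu.1),
          T n a (eraseMid i xu.1, stripDiagram i xu.1) xu.2 xu.1) ∈ D} =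
        (νmix (symmDiff S {i, i + 1})) {x | ((eraseMid i x, stripDiagram i x), x) ∈ D}) →
      (∀ y m, MeasurableSet (Coal y m)) →
      (∀ (y : ℤ) (m : ℕ) (p : Obs × Set (Site 2 × Site 2)) (u : Rnd), (p, u) ∈ Coal y m → ∀ z : Obs,
        (![i + 1, y] ∈ (T (m + 1) (y - m) p u z).1 ↔ ![i + 1, y] ∈ (T (m + 1) (y - m) p u p.1).1) ∧
        (![i, y] ∈ (T (m + 1) (y - m) p u z).2 ↔ ![i, y] ∈ (T (m + 1) (y - m) p u p.1).2) ∧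
        (![i + 1, y] ∈ (T (m + 1) (y - m) p u z).2 ↔ ![i + 1, y] ∈ (T (m + 1) (y - m) p u p.1).2)) →
      (∀ y : ℤ, ((νmix (symmDiff S {i, i + 1})).prod β)
          {xu | ∀ m : ℕ, ((eraseMid i xu.1, stripDiagram i xu.1), xu.2) ∉ Coal y m} = 0) →
      (∀ p u (w : Site 2), w ∈ (g (p, u)).1 ↔ if w 0 = i + 1 then
        ∃ m : ℕ, ((p, u) ∈ Coal (w 1) m ∧ ∀ m' < m, (p, u) ∉ Coal (w 1) m') ∧
          w ∈ (T (m + 1) (w 1 - m) p u p.1).1 else w ∈ p.1.1) →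
      (∀ p u (f : Site 2), f ∈ (g (p, u)).2 ↔ if (f 0 = i ∨ f 0 = i + 1) then
        ∃ m : ℕ, ((p, u) ∈ Coal (f 1) m ∧ ∀ m' < m, (p, u) ∉ Coal (f 1) m') ∧
          f ∈ (T (m + 1) (f 1 - m) p u p.1).2 else f ∈ p.1.2) →
      ((νmix (symmDiff S {i, i + 1})).prod β).map
          (fun xu => ((eraseMid i xu.1, stripDiagram i xu.1),
            g ((eraseMid i xu.1, stripDiagram i xu.1), xu.2))) =
        (νmix (symmDiff S {i, i + 1})).map (fun x => ((eraseMid i x, stripDiagram i x), x)) := by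
  intro S i Φ T Coal g hT hΦm hW hLaw hCm hCs hCfin hg1 hg2
  set ν' := νmix (symmDiff S {i, i + 1}) with hν'
  haveI : IsProbabilityMeasure ν' := isProbabilityMeasure_nuMix _
  haveI : IsProbabilityMeasure β := by
    rw [show β = sitePercolation (Site 2 × ℕ) half from rfl]; infer_instance
  set P' := ν'.prod β with hP'
  set π : Obs → Obs × Set (Site 2 × Site 2) := fun x => (eraseMid i x, stripDiagram i x) with hπdef
  have hπ : Measurable π := ps2_measurable_stat i
  have hgm : Measurable g := ps2_measurable_cftp hT hΦm hCm hg1 hg2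
  set JG : Obs × Rnd → (Obs × Set (Site 2 × Site 2)) × Obs := fun xu => (π xu.1, g (π xu.1, xu.2))
    with hJGdef
  set J : Obs → (Obs × Set (Site 2 × Site 2)) × Obs := fun x => (π x, x) with hJdef
  set Y : ℕ → Obs × Rnd → Obs := fun n xu => T (2 * n + 1) (-(n : ℤ)) (π xu.1) xu.2 xu.1 with hYdef
  have hJG : Measurable JG :=
    (hπ.comp measurable_fst).prodMk (hgm.comp ((hπ.comp measurable_fst).prodMk measurable_snd))
  have hJ : Measurable J := hπ.prodMk measurable_id
  refine ps2_measure_ext_rows _ _ inferInstance inferInstance fun k D hDm hD => ?_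
  rw [Measure.map_apply hJG hDm, Measure.map_apply hJ hDm]
  -- the bad events: no certified depth `≤ n` at row `y`
  set B : ℤ → ℕ → Set (Obs × Rnd) := fun y n => {xu | ∀ m ≤ n, (π xu.1, xu.2) ∉ Coal y m} with hB
  have hπid : Measurable fun xu : Obs × Rnd => (π xu.1, xu.2) := (hπ.comp measurable_fst).prodMk measurable_snd
  have hBm : ∀ y n, MeasurableSet (B y n) := fun y n =>
    measurableSet_setOf.2 (Measurable.forall fun m => Measurable.imp measurable_const
      (measurableSet_setOf.1 ((hCm y m).preimage hπid)).not)
  have hBanti : ∀ y, Antitone (B y) := fun y n n' hnn' xu hxu m hm => hxu m (hm.trans hnn')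
  have hBlim : ∀ y, Tendsto (fun n => P' (B y n)) atTop (𝓝 0) := by
    intro y
    have h := tendsto_measure_iInter_atTop (μ := P') (fun n => (hBm y n).nullMeasurableSet) (hBanti y)
      ⟨0, measure_ne_top _ _⟩
    have hI : (⋂ n, B y n) = {xu | ∀ m : ℕ, (π xu.1, xu.2) ∉ Coal y m} := by
      ext xu
      simp only [hB, mem_iInter, mem_setOf_eq]
      exact ⟨fun h m => h m m le_rfl, fun h n m _ => h m⟩
    rw [hI] at h
    have h0 : P' {xu | ∀ m : ℕ, (π xu.1, xu.2) ∉ Coal y m} = 0 := hCfin y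
    rw [h0] at h
    exact h
  have hsum : Tendsto (fun n : ℕ => ∑ y ∈ Finset.Icc (-(k : ℤ)) k, P' (B y (n - k))) atTop (𝓝 0) := by
    have := tendsto_finsetSum (Finset.Icc (-(k : ℤ)) k)
      fun y _ => (hBlim y).comp (tendsto_sub_atTop_nat k)
    simpa using this
  -- outside the bad events the CFTP output and the sweep agree on the window
  have hincl : ∀ n, k ≤ n → ∀ xu : Obs × Rnd, xu ∉ (⋃ y ∈ Finset.Icc (-(k : ℤ)) k, B y (n - k)) →
      ((π xu.1, g (π xu.1, xu.2)) ∈ D ↔ (π xu.1, Y n xu) ∈ D) := by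
    intro n hkn xu hxu
    refine hD _ _ _ fun w hw1 hw2 => ps2_cftp_agree_window hT hW hCs hg1 hg2 k n hkn xu.1 xu.2
      (fun y hy1 hy2 => ?_) w hw1 hw2
    simp only [mem_iUnion, Finset.mem_Icc, not_exists, exists_prop, not_and] at hxu
    have hy := hxu y ⟨hy1, hy2⟩
    simp only [hB, mem_setOf_eq, not_forall, not_not, exists_prop] at hy
    exact hy
  have hbad : ∀ n, P' (⋃ y ∈ Finset.Icc (-(k : ℤ)) k, B y (n - k)) ≤
      ∑ y ∈ Finset.Icc (-(k : ℤ)) k, P' (B y (n - k)) := fun n => measure_biUnion_finset_le _ _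
  -- the sweeps of the rows `-n … n` from `X'` have the target joint law on events reading rows `≤ n`
  have hνD : ∀ n, k ≤ n → ν' (J ⁻¹' D) = P' ((fun xu => (π xu.1, Y n xu)) ⁻¹' D) := fun n hkn =>
    (hLaw (2 * n + 1) (-(n : ℤ)) D hDm fun p z z' h => hD p z z' fun w hw1 hw2 =>
      h w (by push_cast; omega)).symm
  refine le_antisymm ?_ ?_
  · have ht : Tendsto (fun n : ℕ => ν' (J ⁻¹' D) + ∑ y ∈ Finset.Icc (-(k : ℤ)) k, P' (B y (n - k)))
        atTop (𝓝 (ν' (J ⁻¹' D) + 0)) := tendsto_const_nhds.add hsum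
    rw [add_zero] at ht
    refine ge_of_tendsto ht (eventually_atTop.2 ⟨k, fun n hn => ?_⟩)
    calc P' (JG ⁻¹' D) ≤ P' ((fun xu => (π xu.1, Y n xu)) ⁻¹' D ∪ ⋃ y ∈ Finset.Icc (-(k : ℤ)) k, B y (n - k)) := by
          refine measure_mono fun xu hxu => ?_
          by_cases hb : xu ∈ ⋃ y ∈ Finset.Icc (-(k : ℤ)) k, B y (n - k)
          · exact Or.inr hb
          · exact Or.inl ((hincl n hn xu hb).1 hxu)
      _ ≤ P' ((fun xu => (π xu.1, Y n xu)) ⁻¹' D) + P' (⋃ y ∈ Finset.Icc (-(k : ℤ)) k, B y (n - k)) :=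
          measure_union_le _ _
      _ ≤ ν' (J ⁻¹' D) + ∑ y ∈ Finset.Icc (-(k : ℤ)) k, P' (B y (n - k)) := by
          rw [← hνD n hn]; exact add_le_add le_rfl (hbad n)
  · have ht : Tendsto (fun n : ℕ => P' (JG ⁻¹' D) + ∑ y ∈ Finset.Icc (-(k : ℤ)) k, P' (B y (n - k)))
        atTop (𝓝 (P' (JG ⁻¹' D) + 0)) := tendsto_const_nhds.add hsum
    rw [add_zero] at ht
    refine ge_of_tendsto ht (eventually_atTop.2 ⟨k, fun n hn => ?_⟩)
    calc ν' (J ⁻¹' D) = P' ((fun xu => (π xu.1, Y n xu)) ⁻¹' D) := hνD n hn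
      _ ≤ P' (JG ⁻¹' D ∪ ⋃ y ∈ Finset.Icc (-(k : ℤ)) k, B y (n - k)) := by
          refine measure_mono fun xu hxu => ?_
          by_cases hb : xu ∈ ⋃ y ∈ Finset.Icc (-(k : ℤ)) k, B y (n - k)
          · exact Or.inr hb
          · exact Or.inl ((hincl n hn xu hb).2 hxu)
      _ ≤ P' (JG ⁻¹' D) + P' (⋃ y ∈ Finset.Icc (-(k : ℤ)) k, B y (n - k)) := measure_union_le _ _
      _ ≤ P' (JG ⁻¹' D) + ∑ y ∈ Finset.Icc (-(k : ℤ)) k, P' (B y (n - k)) :=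
          add_le_add le_rfl (hbad n)

end Law

end Summit.CriticalPhenomena.CardyFormulaZ2.Theorems.IKLinearTransport.PinnedDiagramExchange
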